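import Literature.NumberTheory.LFunctions.FeketePolyaKernelCertificates
import Literature.NumberTheory.LFunctions.NoRealZeroOddSmallModuliIII
import Literature.Barriers.RiemannHypothesis.EpsteinZetaRealZerosPairGrouping267
import HarnessLib

/-!
# No real zero for the ODD real primitive characters of conductor `≤ 334`, in the kernel
# (`NoRealZeroOddUpTo 334`)

Topic `Literature/NumberTheory/LFunctions`; namespace `Literature.NumberTheory.LFunctions`
(private helpers in `….OddSmallModuliIV`). THEOREMS only (no definition, no named fact, no `sorry`).

The odd kernel base `266` (`noRealZeroOddUpTo_266`, `NoRealZeroOddSmallModuliIII.lean`) is pushed to `334`: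
**`noRealZeroOddUpTo_334 : NoRealZeroOddUpTo 334`**. Per modulus `266 < q ≤ 334` (one bullet each,
in the order of `interval_cases`): moduli without a primitive quadratic character are dismissed
(`q ≡ 2 (mod 4)`, `16 ∣ q`, `p² ∣ q` — MV Thm 9.13: 17 + 4 + 9 moduli); an even
primitive quadratic character is excluded by the parity test inside `OddSmallModuliII.good_odd_of_*`
(17 moduli); the odd character `χ_{−q}` is certified by the ORDER-TWO Fekete–Pólya criterion
along the induced character mod `q·w` (engine `FeketePolyaKernelCertificates.runOK` of the cell seat
sweep-4, kernel `decide`; 20 moduli, multipliers from an integer scan of this seat, 2026-08-27: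
`280` → `w = 11`; `283` → `w = 3`; `291` → `w = 2`; `292` → `w = 15`; `307` → `w = 3`; `312` → `w = 77`; `323` → `w = 10`; `328` → `w = 33`; `331` → `w = 42`); and the 1 discriminant(s) `267` without such a certificate come from LOW'S GROUPING of
the Epstein zeta functions of the class group
(`Literature/Barriers/RiemannHypothesis/EpsteinZetaRealZerosPairGrouping*.lean`, this seat).

## References

* H. L. Montgomery, R. C. Vaughan, *Multiplicative Number Theory I*, CUP 2007, §9.3 Thm 9.13, §11.2.1
  Exercises 7–8. [MontgomeryVaughan2007]
* M. E. Low, *Real zeros of the Dedekind zeta function of an imaginary quadratic field*, Acta Arith. 14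
  (1968) 117–140. [Low1968]
* M. Watkins, *Real zeros of real odd Dirichlet L-functions*, Math. Comp. 73 (2004) 415–423.
  [Watkins2004RealZeros]
-/

namespace Literature.NumberTheory.LFunctions

namespace OddSmallModuliIV

open FeketePolyaKernel PrimitiveQuadratic OddSmallModuliII
open Literature.Barriers.RiemannHypothesis

/-- Conductor `≡ 2 (mod 4)`: no primitive character (private copy of the sweep-4 lemma).
[cite: MontgomeryVaughan2007, §9.3 Theorem 9.13] -/
private theorem absurd_of_mod_four_two {q : ℕ} [NeZero q] (hq : q % 4 = 2)
    {χ : DirichletCharacter ℂ q} (hprim : χ.IsPrimitive) : False := by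
  obtain ⟨m, rfl⟩ : ∃ m, q = 2 * m := ⟨q / 2, by omega⟩
  haveI : NeZero m := ⟨by omega⟩
  exact not_isPrimitive_two_mul (m := m) (Nat.odd_iff.mpr (by omega)) hprim

/-- Conductor divisible by `16`: no primitive quadratic character (private copy).
[cite: MontgomeryVaughan2007, §9.3 Theorem 9.13] -/
private theorem absurd_of_sixteen_dvd {q : ℕ} [NeZero q] (hq : q % 16 = 0) {χ : DirichletCharacter ℂ q}
    (hprim : χ.IsPrimitive) (hquad : χ.IsQuadratic) : False := by
  obtain ⟨k, m, hm, rfl⟩ := Nat.exists_eq_two_pow_mul_odd (NeZero.ne q)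
  have hm2 := Nat.odd_iff.mp hm
  haveI : NeZero m := ⟨by omega⟩
  have hk := le_three_of_level_two_pow_mul hm hprim hquad
  interval_cases k <;> norm_num at hq <;> omega

/-- Conductor with an odd square factor `p²`: no primitive quadratic character (private copy).
[cite: MontgomeryVaughan2007, §9.3 Theorem 9.13] -/
private theorem absurd_of_sq_dvd {q : ℕ} [NeZero q] {p : ℕ} (hp : p.Prime) (hp2 : p ≠ 2)
    (hpq : p * p ∣ q) {χ : DirichletCharacter ℂ q} (hprim : χ.IsPrimitive) (hquad : χ.IsQuadratic) :
    False := by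
  obtain ⟨k, m, hm, rfl⟩ := Nat.exists_eq_two_pow_mul_odd (NeZero.ne q)
  have hm2 := Nat.odd_iff.mp hm
  haveI : NeZero m := ⟨by omega⟩
  have hsq := squarefree_of_level_two_pow_mul hm hprim hquad
  have hp2' : Nat.Coprime p 2 := (Nat.coprime_primes hp Nat.prime_two).mpr hp2
  have hcop : Nat.Coprime (p * p) (2 ^ k) := Nat.Coprime.pow_right k (Nat.Coprime.mul_left hp2' hp2')
  have hpm : p * p ∣ m := hcop.dvd_of_dvd_mul_left hpq
  exact hp.one_lt.ne' (Nat.isUnit_iff.mp (hsq p hpm))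

/-- **No real zero in `(0, 1)` for every odd real primitive character of conductor `266 < q ≤ 334`**
(one kernel computation per modulus, in the order of `interval_cases`). [cite: MontgomeryVaughan2007, §11.2.1 Exercises 7 (g), 8]
[cite: Low1968, Theorem 5 (via MR 38#4425)] -/
theorem range_267_334 (q : ℕ) [NeZero q] (hlo : 266 < q) (hhi : q ≤ 334) :
    ∀ χ : DirichletCharacter ℂ q, χ.IsQuadratic → χ.IsPrimitive → χ.Odd →
      ∀ σ : ℝ, 0 < σ → σ < 1 → χ.LFunction σ ≠ 0 := by
  interval_cases q
  · -- 267
    exact fun _ hquad hprim hodd _ hσ0 hσ1 ↦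
      LFunction_ne_zero_of_odd_quadratic_267 hprim hquad hodd hσ0 hσ1
  · -- 268
    exact good_odd_of_four (by decide) (by decide) 1 (by decide) (by decide +kernel)
  · -- 269
    exact good_odd_of_odd (by decide) (by decide) 1 (by decide) (by decide +kernel)
  · -- 270
    exact fun χ hquad hprim _ ↦ (absurd_of_mod_four_two (by decide) hprim).elim
  · -- 271
    exact good_odd_of_odd (by decide) (by decide) 1 (by decide) (by decide +kernel)
  · -- 272
    exact fun χ hquad hprim _ ↦ (absurd_of_sixteen_dvd (by decide) hprim hquad).elim
  · -- 273
    exact good_odd_of_odd (by decide) (by decide) 1 (by decide) (by decide +kernel)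
  · -- 274
    exact fun χ hquad hprim _ ↦ (absurd_of_mod_four_two (by decide) hprim).elim
  · -- 275
    exact fun χ hquad hprim _ ↦
      (absurd_of_sq_dvd (p := 5) (by norm_num) (by decide) (by decide) hprim hquad).elim
  · -- 276
    exact good_odd_of_four (by decide) (by decide) 1 (by decide) (by decide +kernel)
  · -- 277
    exact good_odd_of_odd (by decide) (by decide) 1 (by decide) (by decide +kernel)
  · -- 278
    exact fun χ hquad hprim _ ↦ (absurd_of_mod_four_two (by decide) hprim).elim
  · -- 279
    exact fun χ hquad hprim _ ↦
      (absurd_of_sq_dvd (p := 3) (by norm_num) (by decide) (by decide) hprim hquad).elim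
  · -- 280
    exact good_odd_of_eight (by decide) (by decide) 11 (by decide) (by decide +kernel) (by decide +kernel)
  · -- 281
    exact good_odd_of_odd (by decide) (by decide) 1 (by decide) (by decide +kernel)
  · -- 282
    exact fun χ hquad hprim _ ↦ (absurd_of_mod_four_two (by decide) hprim).elim
  · -- 283
    exact good_odd_of_odd (by decide) (by decide) 3 (by decide) (by decide +kernel)
  · -- 284
    exact good_odd_of_four (by decide) (by decide) 1 (by decide) (by decide +kernel)
  · -- 285
    exact good_odd_of_odd (by decide) (by decide) 1 (by decide) (by decide +kernel)
  · -- 286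
    exact fun χ hquad hprim _ ↦ (absurd_of_mod_four_two (by decide) hprim).elim
  · -- 287
    exact good_odd_of_odd (by decide) (by decide) 1 (by decide) (by decide +kernel)
  · -- 288
    exact fun χ hquad hprim _ ↦ (absurd_of_sixteen_dvd (by decide) hprim hquad).elim
  · -- 289
    exact fun χ hquad hprim _ ↦
      (absurd_of_sq_dvd (p := 17) (by norm_num) (by decide) (by decide) hprim hquad).elim
  · -- 290
    exact fun χ hquad hprim _ ↦ (absurd_of_mod_four_two (by decide) hprim).elim
  · -- 291
    exact good_odd_of_odd (by decide) (by decide) 2 (by decide) (by decide +kernel)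
  · -- 292
    exact good_odd_of_four (by decide) (by decide) 15 (by decide) (by decide +kernel)
  · -- 293
    exact good_odd_of_odd (by decide) (by decide) 1 (by decide) (by decide +kernel)
  · -- 294
    exact fun χ hquad hprim _ ↦ (absurd_of_mod_four_two (by decide) hprim).elim
  · -- 295
    exact good_odd_of_odd (by decide) (by decide) 1 (by decide) (by decide +kernel)
  · -- 296
    exact good_odd_of_eight (by decide) (by decide) 1 (by decide) (by decide +kernel) (by decide +kernel)
  · -- 297
    exact fun χ hquad hprim _ ↦
      (absurd_of_sq_dvd (p := 3) (by norm_num) (by decide) (by decide) hprim hquad).elim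
  · -- 298
    exact fun χ hquad hprim _ ↦ (absurd_of_mod_four_two (by decide) hprim).elim
  · -- 299
    exact good_odd_of_odd (by decide) (by decide) 1 (by decide) (by decide +kernel)
  · -- 300
    exact fun χ hquad hprim _ ↦
      (absurd_of_sq_dvd (p := 5) (by norm_num) (by decide) (by decide) hprim hquad).elim
  · -- 301
    exact good_odd_of_odd (by decide) (by decide) 1 (by decide) (by decide +kernel)
  · -- 302
    exact fun χ hquad hprim _ ↦ (absurd_of_mod_four_two (by decide) hprim).elim
  · -- 303
    exact good_odd_of_odd (by decide) (by decide) 1 (by decide) (by decide +kernel)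
  · -- 304
    exact fun χ hquad hprim _ ↦ (absurd_of_sixteen_dvd (by decide) hprim hquad).elim
  · -- 305
    exact good_odd_of_odd (by decide) (by decide) 1 (by decide) (by decide +kernel)
  · -- 306
    exact fun χ hquad hprim _ ↦ (absurd_of_mod_four_two (by decide) hprim).elim
  · -- 307
    exact good_odd_of_odd (by decide) (by decide) 3 (by decide) (by decide +kernel)
  · -- 308
    exact good_odd_of_four (by decide) (by decide) 1 (by decide) (by decide +kernel)
  · -- 309
    exact good_odd_of_odd (by decide) (by decide) 1 (by decide) (by decide +kernel)
  · -- 310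
    exact fun χ hquad hprim _ ↦ (absurd_of_mod_four_two (by decide) hprim).elim
  · -- 311
    exact good_odd_of_odd (by decide) (by decide) 1 (by decide) (by decide +kernel)
  · -- 312
    exact good_odd_of_eight (by decide) (by decide) 77 (by decide) (by decide +kernel) (by decide +kernel)
  · -- 313
    exact good_odd_of_odd (by decide) (by decide) 1 (by decide) (by decide +kernel)
  · -- 314
    exact fun χ hquad hprim _ ↦ (absurd_of_mod_four_two (by decide) hprim).elim
  · -- 315
    exact fun χ hquad hprim _ ↦
      (absurd_of_sq_dvd (p := 3) (by norm_num) (by decide) (by decide) hprim hquad).elim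
  · -- 316
    exact good_odd_of_four (by decide) (by decide) 1 (by decide) (by decide +kernel)
  · -- 317
    exact good_odd_of_odd (by decide) (by decide) 1 (by decide) (by decide +kernel)
  · -- 318
    exact fun χ hquad hprim _ ↦ (absurd_of_mod_four_two (by decide) hprim).elim
  · -- 319
    exact good_odd_of_odd (by decide) (by decide) 1 (by decide) (by decide +kernel)
  · -- 320
    exact fun χ hquad hprim _ ↦ (absurd_of_sixteen_dvd (by decide) hprim hquad).elim
  · -- 321
    exact good_odd_of_odd (by decide) (by decide) 1 (by decide) (by decide +kernel)
  · -- 322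
    exact fun χ hquad hprim _ ↦ (absurd_of_mod_four_two (by decide) hprim).elim
  · -- 323
    exact good_odd_of_odd (by decide) (by decide) 10 (by decide) (by decide +kernel)
  · -- 324
    exact fun χ hquad hprim _ ↦
      (absurd_of_sq_dvd (p := 3) (by norm_num) (by decide) (by decide) hprim hquad).elim
  · -- 325
    exact fun χ hquad hprim _ ↦
      (absurd_of_sq_dvd (p := 5) (by norm_num) (by decide) (by decide) hprim hquad).elim
  · -- 326
    exact fun χ hquad hprim _ ↦ (absurd_of_mod_four_two (by decide) hprim).elim
  · -- 327
    exact good_odd_of_odd (by decide) (by decide) 1 (by decide) (by decide +kernel)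
  · -- 328
    exact good_odd_of_eight (by decide) (by decide) 33 (by decide) (by decide +kernel) (by decide +kernel)
  · -- 329
    exact good_odd_of_odd (by decide) (by decide) 1 (by decide) (by decide +kernel)
  · -- 330
    exact fun χ hquad hprim _ ↦ (absurd_of_mod_four_two (by decide) hprim).elim
  · -- 331
    exact good_odd_of_odd (by decide) (by decide) 42 (by decide) (by decide +kernel)
  · -- 332
    exact good_odd_of_four (by decide) (by decide) 1 (by decide) (by decide +kernel)
  · -- 333
    exact fun χ hquad hprim _ ↦
      (absurd_of_sq_dvd (p := 3) (by norm_num) (by decide) (by decide) hprim hquad).elim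
  · -- 334
    exact fun χ hquad hprim _ ↦ (absurd_of_mod_four_two (by decide) hprim).elim

end OddSmallModuliIV

open OddSmallModuliIV in
/-- **`NoRealZeroOddUpTo 334`, unconditionally**: no odd real primitive character of conductor `≤ 334`
has a real zero in `(0, 1)` (`q ≤ 266`: `noRealZeroOddUpTo_266`; `266 < q ≤ 334`: `range_267_334`).
[cite: Low1968, Theorem 5 (via MR 38#4425)] [cite: MontgomeryVaughan2007, §11.2.1 Exercises 7 (g), 8] -/
theorem noRealZeroOddUpTo_334 : NoRealZeroOddUpTo 334 := by
  intro q _ hq3 hq χ hquad hprim hodd σ hσ0 hσ1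
  by_cases h : q ≤ 266
  · exact noRealZeroOddUpTo_266 q hq3 h χ hquad hprim hodd σ hσ0 hσ1
  · exact range_267_334 q (by omega) hq χ hquad hprim hodd σ hσ0 hσ1

end Literature.NumberTheory.LFunctions
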